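import Mathlib
import Summits.KontsevichZagierPeriods.KontsevichZagierPeriods.Theorems.SoloInformedNashSymbol
import Literature.NumberTheory.Transcendental.CurvePeriodsStokesProofs
import Literature.NumberTheory.Transcendental.KZLogCalculusProofs
import HarnessLib

/-!
# Solo-informed: `κ̃` is `ℚ̄`-linear in the form and kills forms vanishing on the curve

Session s9 of the soloist line `solo-KontsevichZagierPeriods-informed` (file J1 of the Rung-2 plan,
`paper/rung2-v2.md` §5, relations (R1a), (R1b), (R2)). For a Huber–Wüstholz period symbol
`s = (Z, ω, γ)` with a Nash path `γ` and its Kontsevich–Zagier value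
`κ̃(s) = (⟦[[0,1], Re(ω(γ)γ′)]⟧, ⟦[[0,1], Im(ω(γ)γ′)]⟧) ∈ V = P × P` (file B):

* `soloInformedKappaTilde_add_form` — (R1a) `κ̃(Z, ω₁ + ω₂, γ) = κ̃(Z, ω₁, γ) + κ̃(Z, ω₂, γ)`
  (integrand additivity in `P`);
* `soloInformedKappaTilde_smul_form` — (R1b) `κ̃(Z, a ω, γ) = a ⋆ κ̃(Z, ω, γ)` for `a ∈ ℚ̄`, where
  `a ⋆ (u, v) = (Re a • u − Im a • v, Im a • u + Re a • v)` and `F_ℝ` acts on `P` by `[pt, b]·`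
  (file A: `b • ⟦[σ, f]⟧ = ⟦[σ, b f]⟧`);
* `soloInformedKappaTilde_eq_zero_of_vanishesOn` — (R2) `κ̃(Z, ω, γ) = 0` if `ω|_{TZ} = 0`: the
  velocity of a Nash path on `Z` is tangent to `Z` on all of `[0, 1]` (one-sided uniqueness of
  derivatives on `[0, 1]`), so the integrand vanishes identically and `[[0,1], 0] ≡ 0`.

References: Kontsevich–Zagier 2001 §1.2 [KontsevichZagier2001]; Huber–Wüstholz 2022, Def. 7.6,
§13.1 [HuberWuestholz2022].
-/

noncomputable section

open MeasureTheory Set MvPolynomial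
open Literature.NumberTheory.Transcendental Literature.NumberTheory.Transcendental.KZ
open Literature.NumberTheory.Transcendental.CurvePeriods

namespace Summit.KontsevichZagierPeriods.KontsevichZagierPeriods.Theorems

/-! ## 1. Relations in `P` from integrand identities -/

/-- Two representations with the same domain whose integrands agree on it have the same class
in `P`. -/
theorem soloInformed_toFormalPeriod_congr_of_eqOn {n : ℕ} {r r' : IntegralRep n}
    (hd : r'.domain = r.domain) (h : EqOn r.integrand r'.integrand r.domain) :
    toFormalPeriod (of r) = toFormalPeriod (of r') :=
  toFormalPeriod_eq_iff.2 (of_sub_of_mem_relations_of_eqOn hd h)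

/-- Integrand additivity in `P`: `⟦[σ, f₁ + f₂]⟧ = ⟦[σ, f₁]⟧ + ⟦[σ, f₂]⟧`. -/
theorem soloInformed_toFormalPeriod_of_integrand_add {n : ℕ} {r r₁ r₂ : IntegralRep n}
    (h₁ : r₁.domain = r.domain) (h₂ : r₂.domain = r.domain)
    (h : EqOn r.integrand (r₁.integrand + r₂.integrand) r.domain) :
    toFormalPeriod (of r) = toFormalPeriod (of r₁) + toFormalPeriod (of r₂) := by
  rw [← map_add, toFormalPeriod_eq_iff, sub_add_eq_sub_sub]
  exact integrandAddRel_subset_relations ⟨n, r, r₁, r₂, h₁, h₂, h, rfl⟩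

/-! ## 2. The path integrand is additive and homogeneous in the form -/

/-- The path integrand `Σᵢ ωᵢ(γ) γᵢ′` is additive in `ω`. -/
theorem soloInformedPathIntegrand_add_form (Z : CurveData) (hZ : Z.IsSmoothAffineCurve)
    (γ : CurvePath Z) (ω ω₁ ω₂ : Fin Z.n → MvPolynomial (Fin Z.n) ℂ)
    (h : ∀ i, HasAlgCoeffs (ω i)) (h₁ : ∀ i, HasAlgCoeffs (ω₁ i))
    (h₂ : ∀ i, HasAlgCoeffs (ω₂ i)) (hω : ω = ω₁ + ω₂) (t : ℝ) :
    soloInformedPathIntegrand ⟨Z, hZ, ω, h, γ⟩ t =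
      soloInformedPathIntegrand ⟨Z, hZ, ω₁, h₁, γ⟩ t +
        soloInformedPathIntegrand ⟨Z, hZ, ω₂, h₂, γ⟩ t := by
  subst hω
  simp only [soloInformedPathIntegrand, Pi.add_apply, map_add, add_mul, Finset.sum_add_distrib]

/-- The path integrand `Σᵢ ωᵢ(γ) γᵢ′` is homogeneous in `ω`. -/
theorem soloInformedPathIntegrand_smul_form (Z : CurveData) (hZ : Z.IsSmoothAffineCurve)
    (γ : CurvePath Z) (a : ℂ) (ω ω' : Fin Z.n → MvPolynomial (Fin Z.n) ℂ)
    (h : ∀ i, HasAlgCoeffs (ω i)) (h' : ∀ i, HasAlgCoeffs (ω' i)) (hω : ω' = a • ω) (t : ℝ) :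
    soloInformedPathIntegrand ⟨Z, hZ, ω', h', γ⟩ t =
      a * soloInformedPathIntegrand ⟨Z, hZ, ω, h, γ⟩ t := by
  subst hω
  simp only [soloInformedPathIntegrand, Pi.smul_apply, smul_eq_C_mul, map_mul, eval_C,
    Finset.mul_sum, mul_assoc]

/-! ## 3. (R1a), (R1b): `κ̃` is `ℚ̄`-linear in the form -/

/-- **(R1a)** `κ̃(Z, ω₁ + ω₂, γ) = κ̃(Z, ω₁, γ) + κ̃(Z, ω₂, γ)` for a Nash path `γ`.
[Huber–Wüstholz 2022, Def. 7.6 (A)] -/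
theorem soloInformedKappaTilde_add_form (Z : CurveData) (hZ : Z.IsSmoothAffineCurve)
    (γ : CurvePath Z) (hN : SoloInformedIsNashPath γ.toFun)
    (ω ω₁ ω₂ : Fin Z.n → MvPolynomial (Fin Z.n) ℂ)
    (h : ∀ i, HasAlgCoeffs (ω i)) (h₁ : ∀ i, HasAlgCoeffs (ω₁ i))
    (h₂ : ∀ i, HasAlgCoeffs (ω₂ i)) (hω : ω = ω₁ + ω₂) :
    soloInformedKappaTilde ⟨Z, hZ, ω, h, γ⟩ hN =
      soloInformedKappaTilde ⟨Z, hZ, ω₁, h₁, γ⟩ hN +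
        soloInformedKappaTilde ⟨Z, hZ, ω₂, h₂, γ⟩ hN := by
  have hpt := soloInformedPathIntegrand_add_form Z hZ γ ω ω₁ ω₂ h h₁ h₂ hω
  ext
  · rw [SoloInformedV.fst_add, soloInformedKappaTilde_fst, soloInformedKappaTilde_fst,
      soloInformedKappaTilde_fst]
    exact soloInformed_toFormalPeriod_of_integrand_add rfl rfl fun x _ => by
      simp only [soloInformedPathRepRe_integrand, Pi.add_apply, hpt, Complex.add_re]
  · rw [SoloInformedV.snd_add, soloInformedKappaTilde_snd, soloInformedKappaTilde_snd,
      soloInformedKappaTilde_snd]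
    exact soloInformed_toFormalPeriod_of_integrand_add rfl rfl fun x _ => by
      simp only [soloInformedPathRepIm_integrand, Pi.add_apply, hpt, Complex.add_im]

/-- **(R1b)** `κ̃(Z, a ω, γ) = a ⋆ κ̃(Z, ω, γ)` for a Nash path `γ` and `a ∈ ℚ̄`.
[Huber–Wüstholz 2022, Def. 7.6 (A); Kontsevich–Zagier 2001 §1.2] -/
theorem soloInformedKappaTilde_smul_form (Z : CurveData) (hZ : Z.IsSmoothAffineCurve)
    (γ : CurvePath Z) (hN : SoloInformedIsNashPath γ.toFun) (a : SoloInformedCxAlg)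
    (ω ω' : Fin Z.n → MvPolynomial (Fin Z.n) ℂ)
    (h : ∀ i, HasAlgCoeffs (ω i)) (h' : ∀ i, HasAlgCoeffs (ω' i)) (hω : ω' = (a : ℂ) • ω) :
    soloInformedKappaTilde ⟨Z, hZ, ω', h', γ⟩ hN =
      a • soloInformedKappaTilde ⟨Z, hZ, ω, h, γ⟩ hN := by
  have hpt := soloInformedPathIntegrand_smul_form Z hZ γ (a : ℂ) ω ω' h h' hω
  have hre : ∀ t, (soloInformedPathIntegrand ⟨Z, hZ, ω', h', γ⟩ t).re =
      (a : ℂ).re * (soloInformedPathIntegrand ⟨Z, hZ, ω, h, γ⟩ t).re -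
        (a : ℂ).im * (soloInformedPathIntegrand ⟨Z, hZ, ω, h, γ⟩ t).im := fun t => by
    rw [hpt, Complex.mul_re]
  have him : ∀ t, (soloInformedPathIntegrand ⟨Z, hZ, ω', h', γ⟩ t).im =
      (a : ℂ).re * (soloInformedPathIntegrand ⟨Z, hZ, ω, h, γ⟩ t).im +
        (a : ℂ).im * (soloInformedPathIntegrand ⟨Z, hZ, ω, h, γ⟩ t).re := fun t => by
    rw [hpt, Complex.mul_im]
  ext
  · rw [SoloInformedV.fst_smul, soloInformedKappaTilde_fst, soloInformedKappaTilde_fst,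
      soloInformedKappaTilde_snd, soloInformed_smul_toFormalPeriod_of,
      soloInformed_smul_toFormalPeriod_of, eq_sub_iff_add_eq]
    symm
    exact soloInformed_toFormalPeriod_of_integrand_add rfl rfl fun x _ => by
      simp only [soloInformedScaleRep_integrand, soloInformedPathRepRe_integrand,
        soloInformedPathRepIm_integrand, Pi.add_apply, hre, SoloInformedCxAlg.coe_re,
        SoloInformedCxAlg.coe_im]
      ring
  · rw [SoloInformedV.snd_smul, soloInformedKappaTilde_snd, soloInformedKappaTilde_fst,
      soloInformedKappaTilde_snd, soloInformed_smul_toFormalPeriod_of,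
      soloInformed_smul_toFormalPeriod_of]
    exact soloInformed_toFormalPeriod_of_integrand_add rfl rfl fun x _ => by
      simp only [soloInformedScaleRep_integrand, soloInformedPathRepRe_integrand,
        soloInformedPathRepIm_integrand, Pi.add_apply, him, SoloInformedCxAlg.coe_re,
        SoloInformedCxAlg.coe_im]
      ring

/-! ## 4. (R2): forms vanishing on the curve -/

/-- The velocity of a Nash path on `Z` is tangent to `Z` at every `t ∈ [0, 1]` (including the end
points: the derivative within `[0, 1]` of `Fⱼ ∘ γ ≡ 0` is unique). [folklore] -/
theorem soloInformed_deriv_mem_tangentSpace {Z : CurveData} (γ : CurvePath Z)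
    (hN : SoloInformedIsNashPath γ.toFun) {t : ℝ} (ht : t ∈ Icc (0 : ℝ) 1) :
    (fun i => deriv (fun u => γ.toFun u i) t) ∈ Z.tangentSpace (γ.toFun t) := by
  obtain ⟨ε, hε, hcd, -⟩ := hN
  have hε' : (0 : ℝ) < ε := by exact_mod_cast hε
  have htI : t ∈ Ioo (-(ε : ℝ)) (1 + ε) := ⟨by linarith [ht.1], by linarith [ht.2]⟩
  have hd : ∀ i, HasDerivWithinAt (fun u => γ.toFun u i) (deriv (fun u => γ.toFun u i) t)
      (Icc (0 : ℝ) 1) t := fun i =>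
    (soloInformed_differentiableAt_coord hcd htI i).hasDerivAt.hasDerivWithinAt
  intro j
  have H := hasDerivWithinAt_eval_comp hd (Z.F j)
  have H0 : HasDerivWithinAt (fun u => eval (γ.toFun u) (Z.F j)) 0 (Icc (0 : ℝ) 1) t :=
    (hasDerivWithinAt_const t (Icc (0 : ℝ) 1) (0 : ℂ)).congr
      (fun u hu => (γ.mem_points u hu) j) ((γ.mem_points t ht) j)
  exact UniqueDiffWithinAt.eq_deriv _ (uniqueDiffOn_Icc zero_lt_one t ht) H H0

/-- Along a Nash path the integrand of a form vanishing on `Z` is zero on `[0, 1]`. -/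
theorem soloInformedPathIntegrand_eq_zero_of_vanishesOn (s : PeriodSymbol)
    (hN : SoloInformedIsNashPath s.γ.toFun) (hv : VanishesOn s.Z s.ω) {t : ℝ}
    (ht : t ∈ Icc (0 : ℝ) 1) : soloInformedPathIntegrand s t = 0 :=
  hv _ (s.γ.mem_points t ht) _ (soloInformed_deriv_mem_tangentSpace s.γ hN ht)

/-- **(R2)** `κ̃(Z, ω, γ) = 0` for a Nash path `γ` if `ω` vanishes on the tangent spaces of `Z`
(`[[0,1], 0] ≡ 0`). [Huber–Wüstholz 2022, Def. 7.6; Kontsevich–Zagier 2001 §1.2] -/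
theorem soloInformedKappaTilde_eq_zero_of_vanishesOn (s : PeriodSymbol)
    (hN : SoloInformedIsNashPath s.γ.toFun) (hv : VanishesOn s.Z s.ω) :
    soloInformedKappaTilde s hN = 0 := by
  have h0 : ∀ x ∈ soloInformedUnitI, soloInformedPathIntegrand s (x 0) = 0 := fun x hx =>
    soloInformedPathIntegrand_eq_zero_of_vanishesOn s hN hv ⟨hx.1, hx.2⟩
  ext
  · rw [soloInformedKappaTilde_fst, SoloInformedV.fst_zero]
    exact toFormalPeriod_eq_zero_of_mem (of_mem_relations_of_eqOn_zero _ fun x hx => by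
      simp only [soloInformedPathRepRe_integrand, h0 x hx, Complex.zero_re, Pi.zero_apply])
  · rw [soloInformedKappaTilde_snd, SoloInformedV.snd_zero]
    exact toFormalPeriod_eq_zero_of_mem (of_mem_relations_of_eqOn_zero _ fun x hx => by
      simp only [soloInformedPathRepIm_integrand, h0 x hx, Complex.zero_im, Pi.zero_apply])

/-- (R2) for a symbol given by its fields. -/
theorem soloInformedKappaTilde_eq_zero_of_vanishesOn' (Z : CurveData) (hZ : Z.IsSmoothAffineCurve)
    (γ : CurvePath Z) (hN : SoloInformedIsNashPath γ.toFun)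
    (ω : Fin Z.n → MvPolynomial (Fin Z.n) ℂ) (h : ∀ i, HasAlgCoeffs (ω i))
    (hv : VanishesOn Z ω) : soloInformedKappaTilde ⟨Z, hZ, ω, h, γ⟩ hN = 0 :=
  soloInformedKappaTilde_eq_zero_of_vanishesOn ⟨Z, hZ, ω, h, γ⟩ hN hv

end Summit.KontsevichZagierPeriods.KontsevichZagierPeriods.Theorems
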